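import Mathlib
import HarnessLib
import Summits.PneNP.PneNP.Theorems.CnfIdealGenLengthRankDefectRepresentationsJointCutCoord
import Literature.Algebra.Module.EndomorphismRingLocalIdempotents

/-!
# The joint cut lemma — registered stub `stub_jointCutLemma` (crux `RankDefectRepresentations` = stmt-PneNP-18923,
# line `cell-union-merge`, brief §B1 — part 2 of 2)

Two COMMUTING complete orthogonal systems of idempotent matrices `P : X → K^{d×d}`, `Q : Y → K^{d×d}` and an observer `G` with
`rank [P_A, G] ≤ u` for every union `P_A = Σ_{x ∈ A} P x` and `rank [Q_B, G] ≤ v` for every union `Q_B`: then EVERY union of JOINT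
cells `R_C = Σ_{(x,y) ∈ C} P x Q y`, `C ⊆ X × Y` arbitrary, satisfies `rank [R_C, G] ≤ 144 u + 8 v ≤ 144 (u + v)` (`jointCut`,
`stub_jointCutLemma` = the registered signature verbatim with `κ = 144`).

Proof (ADAPTED BASIS).  The products `J (x,y) = P x Q y` are complete orthogonal idempotents of `End(K^d)`, so
`K^d = ⊕ im J p` (`Literature.Algebra.Module.KrullSchmidt.isInternal_range_of_completeOrthogonalIdempotents`), and in a collected
basis (`DirectSum.IsInternal.collectedBasis`) every `P x`, `Q y`, hence every union and every joint union, is a 0/1 DIAGONAL matrix;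
conjugation (`Matrix.toLinAlgEquiv'.trans (LinearMap.toMatrixAlgEquiv b)`) preserves ranks, and the coordinate statement is
`…JointCutCoord.jointCut_coord` (part 1).
HONEST FRAMING: elementary linear algebra for the negative lane of the crux (line `cell-union-merge`, T2); nothing here bears on
P ≠ NP; F-N2 is a FRONTIER formal rung.
-/

set_option linter.dupNamespace false -- `Summit.PneNP.PneNP.…`: summit = sub-problem name (D-0017)

namespace Summit.PneNP.PneNP.Theorems.CnfIdealGenLengthRankDefectRepresentationsJointCutLemma

open Finset Matrix Module
open Summit.PneNP.PneNP.Theorems.CnfIdealGenLengthRankDefectRepresentationsJointCutCoord (jointCut_coord)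

variable {K : Type} [Field K]

section Transfer

/-- **The joint cut lemma** (abstract form, constant `144 u + 8 v`): for two commuting complete orthogonal systems of idempotent
matrices `P`, `Q` and an observer `G` with `rank [P_A, G] ≤ u`, `rank [Q_B, G] ≤ v` for all unions, every union of joint cells
`R_C = Σ_{(x,y) ∈ C} P x Q y` has `rank [R_C, G] ≤ 144 u + 8 v`.  Reduction to `jointCut_coord` by a basis adapted to
`K^d = ⊕_{(x,y)} im (P x Q y)`. [folklore] -/
theorem jointCut {d : ℕ} {X Y : Type} [Fintype X] [Fintype Y]
    (P : X → Matrix (Fin d) (Fin d) K) (Q : Y → Matrix (Fin d) (Fin d) K) (G : Matrix (Fin d) (Fin d) K) (u v : ℕ)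
    (hPi : ∀ x, P x * P x = P x) (hPo : ∀ x x', x ≠ x' → P x * P x' = 0) (hPs : ∑ x, P x = 1)
    (hQi : ∀ y, Q y * Q y = Q y) (hQo : ∀ y y', y ≠ y' → Q y * Q y' = 0) (hQs : ∑ y, Q y = 1)
    (hPQ : ∀ x y, P x * Q y = Q y * P x)
    (hu : ∀ A : Finset X, ((∑ x ∈ A, P x) * G - G * ∑ x ∈ A, P x).rank ≤ u)
    (hv : ∀ B : Finset Y, ((∑ y ∈ B, Q y) * G - G * ∑ y ∈ B, Q y).rank ≤ v)
    (C : Finset (X × Y)) :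
    ((∑ p ∈ C, P p.1 * Q p.2) * G - G * ∑ p ∈ C, P p.1 * Q p.2).rank ≤ 144 * u + 8 * v := by
  classical
  -- the joint system `J (x, y) = P x * Q y`
  obtain ⟨J, hJ⟩ : ∃ J : X × Y → Matrix (Fin d) (Fin d) K, ∀ p, J p = P p.1 * Q p.2 := ⟨_, fun _ => rfl⟩
  have hJmulP : ∀ x p, P x * J p = if p.1 = x then J p else 0 := by
    intro x p
    rw [hJ p, ← Matrix.mul_assoc]
    by_cases h : p.1 = x
    · rw [if_pos h, h, hPi]
    · rw [if_neg h, hPo x p.1 (Ne.symm h), Matrix.zero_mul]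
  have hJmulQ : ∀ y p, Q y * J p = if p.2 = y then J p else 0 := by
    intro y p
    rw [hJ p, ← Matrix.mul_assoc, ← hPQ, Matrix.mul_assoc]
    by_cases h : p.2 = y
    · rw [if_pos h, h, hQi]
    · rw [if_neg h, hQo y p.2 (Ne.symm h), Matrix.mul_zero]
  have hJJ : ∀ p q, J p * J q = if p = q then J p else 0 := by
    intro p q
    conv_lhs => rw [hJ p]
    rw [Matrix.mul_assoc, hJmulQ]
    by_cases h2 : q.2 = p.2
    · rw [if_pos h2, hJmulP]
      by_cases h1 : q.1 = p.1
      · have hpq : p = q := Prod.ext h1.symm h2.symm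
        subst hpq
        rw [if_pos rfl, if_pos rfl]
      · rw [if_neg h1, if_neg (fun h => h1 (by rw [h]))]
    · rw [if_neg h2, Matrix.mul_zero, if_neg (fun h => h2 (by rw [h]))]
  have hJsum : ∑ p, J p = 1 := by
    calc ∑ p : X × Y, J p = ∑ x, ∑ y, P x * Q y := by
            rw [Fintype.sum_prod_type]; exact Finset.sum_congr rfl fun x _ => Finset.sum_congr rfl fun y _ => hJ (x, y)
      _ = ∑ x, P x * ∑ y, Q y := by simp_rw [Finset.mul_sum]
      _ = 1 := by rw [hQs]; simp [hPs]
  -- the idempotent endomorphisms and the adapted basis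
  obtain ⟨e, he⟩ : ∃ e : X × Y → Module.End K (Fin d → K), ∀ p, e p = Matrix.toLinAlgEquiv' (J p) := ⟨_, fun _ => rfl⟩
  have hce : CompleteOrthogonalIdempotents e :=
    { idem := fun p => by
        show e p * e p = e p
        rw [he p, ← map_mul, hJJ, if_pos rfl]
      ortho := fun p q hpq => by
        show e p * e q = 0
        rw [he p, he q, ← map_mul, hJJ, if_neg hpq, map_zero]
      complete := by
        have : ∑ p, e p = ∑ p, Matrix.toLinAlgEquiv' (R := K) (J p) := Finset.sum_congr rfl fun p _ => he p
        rw [this, ← map_sum, hJsum, map_one] }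
  have hInt := Literature.Algebra.Module.KrullSchmidt.isInternal_range_of_completeOrthogonalIdempotents hce
  obtain ⟨b, hb⟩ : ∃ b : Basis (Σ p : X × Y, Fin (finrank K (LinearMap.range (e p)))) K (Fin d → K),
      ∀ a, b a ∈ LinearMap.range (e a.1) :=
    ⟨hInt.collectedBasis fun p => Module.finBasis K (LinearMap.range (e p)), hInt.collectedBasis_mem _⟩
  have hPb : ∀ x a, P x *ᵥ b a = if a.1.1 = x then b a else 0 := by
    intro x a
    obtain ⟨w, hw⟩ := LinearMap.mem_range.1 (hb a)
    rw [← hw, he, Matrix.toLinAlgEquiv'_apply, Matrix.mulVec_mulVec, hJmulP]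
    split_ifs
    · rfl
    · exact Matrix.zero_mulVec _
  have hQb : ∀ y a, Q y *ᵥ b a = if a.1.2 = y then b a else 0 := by
    intro y a
    obtain ⟨w, hw⟩ := LinearMap.mem_range.1 (hb a)
    rw [← hw, he, Matrix.toLinAlgEquiv'_apply, Matrix.mulVec_mulVec, hJmulQ]
    split_ifs
    · rfl
    · exact Matrix.zero_mulVec _
  -- conjugation into the adapted basis
  obtain ⟨Φ, hΦ, hΦrank⟩ : ∃ Φ : Matrix (Fin d) (Fin d) K ≃ₐ[K] Matrix (Σ p : X × Y, Fin (finrank K (LinearMap.range (e p))))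
      (Σ p : X × Y, Fin (finrank K (LinearMap.range (e p)))) K,
      (∀ M a a', Φ M a a' = b.repr (M *ᵥ b a') a) ∧ ∀ M, (Φ M).rank = M.rank := by
    refine ⟨Matrix.toLinAlgEquiv'.trans (LinearMap.toMatrixAlgEquiv b), fun M a a' => ?_, fun M => ?_⟩
    · change LinearMap.toMatrix b b (Matrix.toLin' M) a a' = _
      rw [LinearMap.toMatrix_apply, Matrix.toLin'_apply]
    · change (LinearMap.toMatrix b b (Matrix.toLin' M)).rank = M.rank
      rw [Matrix.rank_eq_finrank_range_toLin (LinearMap.toMatrix b b (Matrix.toLin' M)) b b, Matrix.toLin_toMatrix,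
        Matrix.rank_eq_finrank_range_toLin M (Pi.basisFun K (Fin d)) (Pi.basisFun K (Fin d)), Matrix.toLin_eq_toLin']
  have hΦP : ∀ x, Φ (P x) = Matrix.diagonal fun a => if a.1.1 = x then (1 : K) else 0 := by
    intro x
    ext a a'
    rw [hΦ, hPb, Matrix.diagonal_apply]
    by_cases h : a'.1.1 = x
    · rw [if_pos h, b.repr_self, Finsupp.single_apply]
      by_cases haa : a = a'
      · subst haa; simp [h]
      · simp [haa, Ne.symm haa]
    · rw [if_neg h, map_zero, Finsupp.zero_apply]
      by_cases haa : a = a'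
      · subst haa; simp [h]
      · simp [haa]
  have hΦQ : ∀ y, Φ (Q y) = Matrix.diagonal fun a => if a.1.2 = y then (1 : K) else 0 := by
    intro y
    ext a a'
    rw [hΦ, hQb, Matrix.diagonal_apply]
    by_cases h : a'.1.2 = y
    · rw [if_pos h, b.repr_self, Finsupp.single_apply]
      by_cases haa : a = a'
      · subst haa; simp [h]
      · simp [haa, Ne.symm haa]
    · rw [if_neg h, map_zero, Finsupp.zero_apply]
      by_cases haa : a = a'
      · subst haa; simp [h]
      · simp [haa]
  have hΦPA : ∀ A : Finset X, Φ (∑ x ∈ A, P x) = Matrix.diagonal fun a => if a.1.1 ∈ A then (1 : K) else 0 := by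
    intro A
    rw [map_sum]
    ext a a'
    rw [Matrix.sum_apply, Matrix.diagonal_apply]
    simp_rw [hΦP, Matrix.diagonal_apply]
    by_cases haa : a = a'
    · subst haa; simp [Finset.sum_ite_eq]
    · simp [haa]
  have hΦQB : ∀ B : Finset Y, Φ (∑ y ∈ B, Q y) = Matrix.diagonal fun a => if a.1.2 ∈ B then (1 : K) else 0 := by
    intro B
    rw [map_sum]
    ext a a'
    rw [Matrix.sum_apply, Matrix.diagonal_apply]
    simp_rw [hΦQ, Matrix.diagonal_apply]
    by_cases haa : a = a'
    · subst haa; simp [Finset.sum_ite_eq]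
    · simp [haa]
  have hΦR : Φ (∑ p ∈ C, P p.1 * Q p.2) = Matrix.diagonal fun a => if a.1 ∈ C then (1 : K) else 0 := by
    rw [map_sum]
    ext a a'
    rw [Matrix.sum_apply, Matrix.diagonal_apply]
    simp_rw [map_mul, hΦP, hΦQ, Matrix.diagonal_mul_diagonal, Matrix.diagonal_apply]
    by_cases haa : a = a'
    · subst haa
      simp only [if_true]
      have : ∀ p : X × Y, ((if a.1.1 = p.1 then (1 : K) else 0) * if a.1.2 = p.2 then (1 : K) else 0) =
          if a.1 = p then 1 else 0 := by
        intro p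
        by_cases h1 : a.1.1 = p.1 <;> by_cases h2 : a.1.2 = p.2 <;> simp [h1, h2, Prod.ext_iff]
      simp_rw [this]
      exact Finset.sum_ite_eq C a.1 (fun _ => (1 : K))
    · simp [haa]
  -- transfer
  have key := jointCut_coord (K := K) (fun a : (Σ p : X × Y, Fin (finrank K (LinearMap.range (e p)))) => a.1) (Φ G) u v
    (fun A => by
      have h := hu A
      rw [← hΦrank, map_sub, map_mul, map_mul, hΦPA] at h
      exact h)
    (fun B => by
      have h := hv B
      rw [← hΦrank, map_sub, map_mul, map_mul, hΦQB] at h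
      exact h) C
  rw [← hΦrank, map_sub, map_mul, map_mul, hΦR]
  exact key

/-- **Registered stub `stub_jointCutLemma`** (crux stmt-PneNP-18923 `RankDefectRepresentations`, line `cell-union-merge`, T2 / brief
§B1; signature verbatim from `Cruxes/RankDefectRepresentations/Lines/cell_union_merge.lean`), with `κ = 144`: unions of joint cells of two
commuting exact cell systems stay cheap against any observer that is cheap against all unions of each system separately.  Proof:
`jointCut` and `144 u + 8 v ≤ 144 (u + v)`. [folklore] -/
theorem stub_jointCutLemma :
    ∃ κ : ℕ,
    ∀ (K : Type) [Field K] (d : ℕ) (X Y : Type) [Fintype X] [Fintype Y]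
      (P : X → Matrix (Fin d) (Fin d) K) (Q : Y → Matrix (Fin d) (Fin d) K) (G : Matrix (Fin d) (Fin d) K) (u v : ℕ),
      (∀ x, P x * P x = P x) → (∀ x x', x ≠ x' → P x * P x' = 0) → ∑ x, P x = 1 →
      (∀ y, Q y * Q y = Q y) → (∀ y y', y ≠ y' → Q y * Q y' = 0) → ∑ y, Q y = 1 →
      (∀ x y, P x * Q y = Q y * P x) →
      (∀ A : Finset X, ((∑ x ∈ A, P x) * G - G * ∑ x ∈ A, P x).rank ≤ u) →
      (∀ B : Finset Y, ((∑ y ∈ B, Q y) * G - G * ∑ y ∈ B, Q y).rank ≤ v) →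
      ∀ C : Finset (X × Y),
        ((∑ p ∈ C, P p.1 * Q p.2) * G - G * ∑ p ∈ C, P p.1 * Q p.2).rank ≤ κ * (u + v) := by
  refine ⟨144, ?_⟩
  intro K _ d X Y _ _ P Q G u v hPi hPo hPs hQi hQo hQs hPQ hu hv C
  exact (jointCut P Q G u v hPi hPo hPs hQi hQo hQs hPQ hu hv C).trans (by omega)

end Transfer

end Summit.PneNP.PneNP.Theorems.CnfIdealGenLengthRankDefectRepresentationsJointCutLemma
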